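import Literature.NumberTheory.EllipticCurves.HeegnerPointsKolyvaginSplitDescentExactProofs
import Literature.NumberTheory.EllipticCurves.HeegnerPointsKolyvaginSplitDescentPairProofs
import HarnessLib

/-!
# EXACTNESS for the PAIR `(E, E^D)` over `ℚ` from a deep depth-one certificate, any prime `p`:
# `Sel₁ = ℤx` and `#Sel₂ = p^{2M₀}` (pair-language form of `card_sel_eq_of_primitive`)

Sequel of `HeegnerPointsKolyvaginSplitDescentExactProofs` (`SplitHypothesesM.card_sel_eq_of_primitive`:
McCallum Thm. 5.4 / Cor. 5.6 in the case `M₁ = 0`, split form) and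
`HeegnerPointsKolyvaginSplitDescentPairProofs` (`PairHypothesesM`, Kolyvagin's frame `(E, E^D)` over
`ℚ` at `l = 2`: the split data on `V₁ × V₂`). For the pair the Cassels–Tate input is TWO pairings —
`P₁` on `Sel₁` (vanishing against `x`, non-degenerate modulo `ℤx`) and `P₂` on `Sel₂`
(non-degenerate) — whose direct sum `prodPairing P₁ P₂` on `Sel₁ × Sel₂` is automatically
cross-isotropic; the annihilator splits as `p^{E₀} Sel₁ ⊆ ℤx`, `p^{E₀} Sel₂ = 0`. Conclusion
(`PairHypothesesM.sel₁_eq_and_card_sel₂_eq_of_primitive`): from a `p`-PRIMITIVE odd-depth class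
`c₂(ℓ₀)` (`P_{ℓ₀} ∉ pE(K_{ℓ₀})`, `ℓ₀` a Kolyvagin prime of the data) — **`Sel₁ = ℤx` and
`#Sel₂ = p^{2M₀}`**: at `p = 2`, `Ш(E^{ε}/ℚ)_{2^M} = 0` with `E^{ε}(ℚ)/2^M = ℤ/2^M · x₀`, and
`#Sel_{2^M}(E^{-ε}/ℚ) = #Ш(E^{-ε}/ℚ)_{2^M} = 4^{M₀}` (`M₀ = ord₂ [E^{ε}(ℚ) : ℤ y]`), GRANTED the
displayed inputs `hCTV` (Cassels–Tate value formula), `hCeb` (Prop. 3.1 kernel form for pure classes)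
in the currency of `toSplit` (their discharge at `2` is the business of the BSD route
`GenusKolyvaginAtTwo`, memo S7 v2/v3 on its item 24882). No definition of mathematical content beyond
the sum pairing; no named fact; nothing here is a claim about BSD.

## References

* W. G. McCallum, *Kolyvagin's work on Shafarevich–Tate groups*, LMS LNS 153 (1991): Thm. 5.4,
  Cor. 5.6. [McCallumLMS1991]
* V. A. Kolyvagin, Izv. 1989, Thm. `B_l` (l = 2), §3. [Kolyvagin1989Izv]
-/

open scoped Classical

namespace Literature.NumberTheory.EllipticCurves

namespace KolyvaginDescent

namespace PairHypothesesM

variable {V₁ V₂ : Type*} [AddCommGroup V₁] [AddCommGroup V₂] {Pl : Type*}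
variable (S : PairHypothesesM V₁ V₂ Pl)

/-! ### The sum of two pairings on `Sel₁ × Sel₂` -/

/-- First component of a class of `Sel₁ × Sel₂`, as an element of `Sel₁`. [folklore] -/
def fstSel (z : S.toSplit.Sel) : S.Sel₁ := ⟨z.1.1, (AddSubgroup.mem_prod.mp z.2).1⟩

/-- Second component of a class of `Sel₁ × Sel₂`, as an element of `Sel₂`. [folklore] -/
def sndSel (z : S.toSplit.Sel) : S.Sel₂ := ⟨z.1.2, (AddSubgroup.mem_prod.mp z.2).2⟩

/-- `fstSel` is additive. [folklore] -/
private theorem fstSel_add (z t : S.toSplit.Sel) : S.fstSel (z + t) = S.fstSel z + S.fstSel t :=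
  Subtype.ext rfl

/-- `sndSel` is additive. [folklore] -/
private theorem sndSel_add (z t : S.toSplit.Sel) : S.sndSel (z + t) = S.sndSel z + S.sndSel t :=
  Subtype.ext rfl

/-- **The direct sum of the two Cassels–Tate pairings** on `Sel = Sel₁ × Sel₂`:
`P((z₁,z₂),(t₁,t₂)) = P₁(z₁,t₁) + P₂(z₂,t₂)` (for the pair `(E, E^D)` over `ℚ`: the Cassels–Tate
pairings of the two members; McCallum §2 (1) for each). [cite: McCallumLMS1991, §2 (1)] -/
noncomputable def prodPairing {R : Type*} [AddCommGroup R] (P₁ : S.Sel₁ →+ S.Sel₁ →+ R)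
    (P₂ : S.Sel₂ →+ S.Sel₂ →+ R) : S.toSplit.Sel →+ S.toSplit.Sel →+ R :=
  AddMonoidHom.mk' (fun z ↦ AddMonoidHom.mk' (fun t ↦ P₁ (S.fstSel z) (S.fstSel t) +
      P₂ (S.sndSel z) (S.sndSel t)) fun t t' ↦ by
        rw [S.fstSel_add, S.sndSel_add, map_add, map_add]; abel)
    fun z z' ↦ by
      ext t
      simp only [AddMonoidHom.mk'_apply, AddMonoidHom.add_apply, S.fstSel_add, S.sndSel_add,
        map_add]
      abel

/-- Unfolding `prodPairing`: `P((z₁,z₂),(t₁,t₂)) = P₁(z₁,t₁) + P₂(z₂,t₂)`.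
[cite: McCallumLMS1991, §2 (1)] -/
theorem prodPairing_apply {R : Type*} [AddCommGroup R] (P₁ : S.Sel₁ →+ S.Sel₁ →+ R)
    (P₂ : S.Sel₂ →+ S.Sel₂ →+ R) (z t : S.toSplit.Sel) :
    S.prodPairing P₁ P₂ z t = P₁ (S.fstSel z) (S.fstSel t) + P₂ (S.sndSel z) (S.sndSel t) := rfl

/-- `v ∈ V^{(1)} ↔ v.2 = 0`. [folklore] -/
private theorem mem_eig_one {v : V₁ × V₂} : v ∈ S.toSplit.eig 1 ↔ v.2 = 0 := by
  change v ∈ pairEig V₁ V₂ 1 ↔ _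
  simp [pairEig, AddSubgroup.mem_prod]

/-- `v ∈ V^{(-1)} ↔ v.1 = 0`. [folklore] -/
private theorem mem_eig_neg_one {v : V₁ × V₂} : v ∈ S.toSplit.eig (-1) ↔ v.1 = 0 := by
  change v ∈ pairEig V₁ V₂ (-1) ↔ _
  simp [pairEig, AddSubgroup.mem_prod]

/-! ### Exactness for the pair -/

/-- **Exactness for the pair from a deep depth-one certificate** (McCallum Thm. 5.4 / Cor. 5.6, case
`M₁ = 0`; Kolyvagin's frame `(E, E^D)` over `ℚ`, any prime `p`). Inputs: `Sel₁`, `Sel₂` finite;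
`P₁` on `Sel₁` alternating, vanishing against `x`, non-degenerate modulo `ℤx`; `P₂` on `Sel₂`
alternating, non-degenerate; the value formula `hCTV` and Čebotarev `hCeb` (pure classes) for the
split data `S.toSplit` with the sum pairing; annihilators `p^{E₀} Sel₁ ⊆ ℤx`, `p^{E₀} Sel₂ = 0` with
`E₀ + M₀ ≤ M`, `M₀ ≤ M`; a Kolyvagin prime `ℓ₀` with `p^{M−1} c₂(ℓ₀) ≠ 0` (`P_{ℓ₀}` `p`-primitive).
Conclusion: **`Sel₁ = ℤx` and `#Sel₂ = p^{2M₀}`.** [cite: McCallumLMS1991, Thm. 5.4, Cor. 5.6 (case M₁ = 0)]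
[cite: Kolyvagin1989Izv, §3] -/
theorem sel₁_eq_and_card_sel₂_eq_of_primitive [Finite S.Sel₁] [Finite S.Sel₂]
    (P₁ : S.Sel₁ →+ S.Sel₁ →+ AddCircle (1 : ℚ)) (halt₁ : ∀ z, P₁ z z = 0)
    (hPx : ∀ t, P₁ ⟨S.x, S.x_mem⟩ t = 0)
    (hnd₁ : ∀ z : S.Sel₁, (∀ t, P₁ z t = 0) → (z : V₁) ∈ AddSubgroup.zmultiples S.x)
    (P₂ : S.Sel₂ →+ S.Sel₂ →+ AddCircle (1 : ℚ)) (halt₂ : ∀ z, P₂ z z = 0)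
    (hnd₂ : ∀ z : S.Sel₂, (∀ t, P₂ z t = 0) → z = 0)
    (hCTV : ∀ ℓ m : ℕ, S.Kol ℓ → KolSupp S.Kol (ℓ * m) → ¬ ℓ ∣ m →
      ∀ (j N a b : ℕ) (t : V₁ × V₂) (ht : t ∈ S.toSplit.Sel)
        (hz : ((S.p : ℤ) ^ j) • S.toSplit.c (ℓ * m) ∈ S.toSplit.Sel),
      ((S.p : ℤ) ^ N) • t = 0 → t ∈ S.toSplit.eig (1 * (-1) ^ (ℓ * m).primeFactors.card) →
      (∀ q ∈ m.primeFactors, t ∈ S.toSplit.A q) → S.M - S.M₀ ≤ j → N + S.M₀ ≤ S.M → N ≤ j →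
      a + b + 1 = N → ((S.p : ℤ) ^ (a + (j - N))) • S.toSplit.c m ∉ S.toSplit.A ℓ →
      ((S.p : ℤ) ^ b) • t ∉ S.toSplit.A ℓ →
      S.prodPairing P₁ P₂ ⟨_, hz⟩ ⟨t, ht⟩ ≠ 0)
    (hCeb : ∀ (T : Finset (V₁ × V₂)) (g₁ g₂ : V₁ × V₂) (ν : ℤ), (ν = 1 ∨ ν = -1) →
      g₁ ∈ S.toSplit.eig ν → g₂ ∈ S.toSplit.eig (-ν) →
      (∀ t ∈ T, ∃ e : ℤ, (e = 1 ∨ e = -1) ∧ t ∈ S.toSplit.eig e) → ∀ b : ℕ,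
      ∃ ℓ, b < ℓ ∧ S.Kol ℓ ∧ ∀ g ∈ AddSubgroup.closure (insert g₁ (insert g₂ (T : Set (V₁ × V₂)))),
        (∃ e : ℤ, (e = 1 ∨ e = -1) ∧ g ∈ S.toSplit.eig e) →
        (g ∈ S.toSplit.A ℓ ↔ g ∈ AddSubgroup.closure (T : Set (V₁ × V₂))))
    {E₀ : ℕ} (hkill₁ : ∀ t ∈ S.Sel₁, ((S.p : ℤ) ^ E₀) • t ∈ AddSubgroup.zmultiples S.x)
    (hkill₂ : ∀ t ∈ S.Sel₂, ((S.p : ℤ) ^ E₀) • t = 0)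
    (hE : E₀ + S.M₀ ≤ S.M) (hM₀ : S.M₀ ≤ S.M)
    {ℓ₀ : ℕ} (hℓ₀ : S.Kol ℓ₀) (hc₀ : ((S.p : ℤ) ^ (S.M - 1)) • S.c₂ ℓ₀ ≠ 0) :
    S.Sel₁ = AddSubgroup.zmultiples S.x ∧ Nat.card S.Sel₂ = S.p ^ (2 * S.M₀) := by
  -- finiteness of `Sel₁ × Sel₂`
  haveI : Finite S.toSplit.Sel := by
    change Finite (S.Sel₁.prod S.Sel₂)
    exact Finite.of_equiv _ (AddSubgroup.prodEquiv S.Sel₁ S.Sel₂).toEquiv.symm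
  set P := S.prodPairing P₁ P₂ with hP
  -- the split inputs
  have halt : ∀ z, P z z = 0 := fun z ↦ by rw [hP, prodPairing_apply, halt₁, halt₂, add_zero]
  have hPcross : ∀ z t : S.toSplit.Sel, (z : V₁ × V₂) ∈ S.toSplit.eig S.toSplit.ε →
      (t : V₁ × V₂) ∈ S.toSplit.eig (-S.toSplit.ε) → P z t = 0 := by
    intro z t hz ht
    change (z : V₁ × V₂) ∈ S.toSplit.eig 1 at hz
    change (t : V₁ × V₂) ∈ S.toSplit.eig (-1) at ht
    have hz2 : S.sndSel z = 0 := Subtype.ext (S.mem_eig_one.mp hz)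
    have ht1 : S.fstSel t = 0 := Subtype.ext (S.mem_eig_neg_one.mp ht)
    rw [hP, prodPairing_apply, hz2, ht1, map_zero, map_zero, AddMonoidHom.zero_apply, zero_add]
  have hx : (⟨S.toSplit.x, S.toSplit.x_mem⟩ : S.toSplit.Sel) =
      ⟨(S.x, 0), AddSubgroup.mem_prod.mpr ⟨S.x_mem, S.Sel₂.zero_mem⟩⟩ := rfl
  have hPx' : ∀ t, P ⟨S.toSplit.x, S.toSplit.x_mem⟩ t = 0 := by
    intro t
    rw [hP, prodPairing_apply]
    have h1 : S.fstSel ⟨S.toSplit.x, S.toSplit.x_mem⟩ = ⟨S.x, S.x_mem⟩ := Subtype.ext rfl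
    have h2 : S.sndSel ⟨S.toSplit.x, S.toSplit.x_mem⟩ = 0 := Subtype.ext rfl
    rw [h1, h2, hPx, map_zero, AddMonoidHom.zero_apply, add_zero]
  have hnd : ∀ z : S.toSplit.Sel, (∀ t, P z t = 0) →
      (z : V₁ × V₂) ∈ AddSubgroup.zmultiples S.toSplit.x := by
    intro z hz
    -- test against `(t₁, 0)` and `(0, t₂)`
    have h1 : ∀ t₁ : S.Sel₁, P₁ (S.fstSel z) t₁ = 0 := by
      intro t₁
      have h := hz ⟨((t₁ : V₁), 0), AddSubgroup.mem_prod.mpr ⟨t₁.2, S.Sel₂.zero_mem⟩⟩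
      rw [hP, prodPairing_apply] at h
      have hs : S.sndSel ⟨((t₁ : V₁), (0 : V₂)), AddSubgroup.mem_prod.mpr ⟨t₁.2, S.Sel₂.zero_mem⟩⟩ = 0 :=
        Subtype.ext rfl
      have hf : S.fstSel ⟨((t₁ : V₁), (0 : V₂)), AddSubgroup.mem_prod.mpr ⟨t₁.2, S.Sel₂.zero_mem⟩⟩ = t₁ :=
        Subtype.ext rfl
      rwa [hs, hf, map_zero, add_zero] at h
    have h2 : ∀ t₂ : S.Sel₂, P₂ (S.sndSel z) t₂ = 0 := by
      intro t₂
      have h := hz ⟨((0 : V₁), (t₂ : V₂)), AddSubgroup.mem_prod.mpr ⟨S.Sel₁.zero_mem, t₂.2⟩⟩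
      rw [hP, prodPairing_apply] at h
      have hf : S.fstSel ⟨((0 : V₁), (t₂ : V₂)), AddSubgroup.mem_prod.mpr ⟨S.Sel₁.zero_mem, t₂.2⟩⟩ = 0 :=
        Subtype.ext rfl
      have hs : S.sndSel ⟨((0 : V₁), (t₂ : V₂)), AddSubgroup.mem_prod.mpr ⟨S.Sel₁.zero_mem, t₂.2⟩⟩ = t₂ :=
        Subtype.ext rfl
      rwa [hf, hs, map_zero, zero_add] at h
    obtain ⟨k, hk⟩ := AddSubgroup.mem_zmultiples_iff.mp (hnd₁ _ h1)
    have hz2 : (S.sndSel z : V₂) = 0 := congrArg Subtype.val (hnd₂ _ h2)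
    refine AddSubgroup.mem_zmultiples_iff.mpr ⟨k, ?_⟩
    change k • (S.x, (0 : V₂)) = (z : V₁ × V₂)
    refine Prod.ext ?_ ?_
    · exact hk
    · change k • (0 : V₂) = (z : V₁ × V₂).2
      rw [smul_zero]
      exact hz2.symm
  have hkill : ∀ t ∈ S.toSplit.Sel, ((S.toSplit.p : ℤ) ^ E₀) • t ∈
      AddSubgroup.zmultiples S.toSplit.x := by
    intro t ht
    change t ∈ S.Sel₁.prod S.Sel₂ at ht
    obtain ⟨h₁, h₂⟩ := AddSubgroup.mem_prod.mp ht
    obtain ⟨k, hk⟩ := AddSubgroup.mem_zmultiples_iff.mp (hkill₁ t.1 h₁)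
    refine AddSubgroup.mem_zmultiples_iff.mpr ⟨k, ?_⟩
    change k • (S.x, (0 : V₂)) = ((S.p : ℤ) ^ E₀) • t
    exact Prod.ext (by simpa using hk) (by simpa using (hkill₂ t.2 h₂).symm)
  -- the split exactness theorem
  have hc₀' : ((S.toSplit.p : ℤ) ^ (S.toSplit.M - 1)) • S.toSplit.c ℓ₀ ≠ 0 := by
    have hodd : Odd ℓ₀.primeFactors.card := by
      rw [card_primeFactors_prime (S.prime_of_kol ℓ₀ hℓ₀)]; exact odd_one
    have hne : ¬ Even ℓ₀.primeFactors.card := Nat.not_even_iff_odd.mpr hodd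
    change ((S.p : ℤ) ^ (S.M - 1)) • pairClass S.c₁ S.c₂ ℓ₀ ≠ 0
    simp only [pairClass, hne, if_false]
    intro h
    exact hc₀ (by simpa using congrArg Prod.snd h)
  obtain ⟨hcard, hε⟩ := S.toSplit.card_sel_eq_of_primitive P halt hPcross hPx' hnd hCTV hCeb hkill
    hE hM₀ hℓ₀ hc₀'
  -- read back: `Sel₁ = ℤx`
  have hSel₁ : S.Sel₁ = AddSubgroup.zmultiples S.x := by
    refine le_antisymm (fun s hs ↦ ?_) (AddSubgroup.zmultiples_le_of_mem S.x_mem)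
    have hmem : ((s, (0 : V₂)) : V₁ × V₂) ∈ S.toSplit.Sel :=
      AddSubgroup.mem_prod.mpr ⟨hs, S.Sel₂.zero_mem⟩
    have h := hε (s, 0) hmem (S.mem_eig_one.mpr rfl)
    obtain ⟨k, hk⟩ := AddSubgroup.mem_zmultiples_iff.mp h
    exact AddSubgroup.mem_zmultiples_iff.mpr ⟨k, congrArg Prod.fst hk⟩
  refine ⟨hSel₁, ?_⟩
  -- and `#Sel₂ = p^{2M₀}` from `#Sel = p^M · p^{2M₀}`, `#Sel₁ = p^M`
  have hcard₁ : Nat.card S.Sel₁ = S.p ^ S.M := by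
    rw [hSel₁, Nat.card_zmultiples, addOrderOf_eq_prime_pow S.hp (S.torsion₁ S.x) S.x_ord]
  have hprod : Nat.card S.toSplit.Sel = Nat.card S.Sel₁ * Nat.card S.Sel₂ := by
    change Nat.card (S.Sel₁.prod S.Sel₂) = _
    rw [Nat.card_congr (AddSubgroup.prodEquiv S.Sel₁ S.Sel₂).toEquiv, Nat.card_prod]
  have hppos : 0 < S.p ^ S.M := pow_pos S.hp.pos _
  have h := hcard
  rw [hprod, hcard₁] at h
  exact Nat.eq_of_mul_eq_mul_left hppos h

end PairHypothesesM

end KolyvaginDescent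

end Literature.NumberTheory.EllipticCurves
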